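import Literature.Analysis.FluidPDE.CheskidovHelmholtzForces
import Literature.Analysis.FluidPDE.TwoHalfNavierStokes
import Literature.Analysis.FluidPDE.LongTimeAveragePeriodic
import HarnessLib

/-!
# Cheskidov's periodisation, VI: assembly of Theorem 1.3 from the total-dissipation family

Analysis/FluidPDE file completing the proof of the §6 periodisation step of Cheskidov,
arXiv:2311.04182 (2023): the vendored **turb.S12** fact
`Literature.Analysis.FluidPDE.cheskidov_time_periodic_anomaly` (`ZerothLaw.lean`; Thm. 1.3 of the
source, solenoidally normalised forces, `ℓ = 1`, no `U`-normalisation) follows from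

* `Literature.Analysis.FluidPDE.cheskidov_total_dissipation_family` — the §§3–4 mixing core
  (Alberti–Crippa–Mazzucato / Bruè–De Lellis drifts, advection–diffusion solutions with the total
  dissipation anomaly (6.4)), a named fact (`CheskidovTotalDissipation.lean`);
* `Literature.Analysis.FunctionSpaces.Torus.smooth_leray_helmholtz (Fin 2)` — the smooth
  space–time Leray–Helmholtz decomposition on `T²` (named fact, `TorusLerayHelmholtz.lean`), used
  to move the gradient part of the drift force into the pressure (the target asks for
  divergence-free forces, a normalisation the source leaves implicit).

Main results: `cheskidov_time_periodic_anomaly_of_family` (and the `FamilyData` form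
`CheskidovPeriodic.FamilyData.cheskidov_time_periodic_anomaly`). The witnesses (§6, p. 18–19 with
`τ = 1`, `a_m = 1`): `u^{ν_m} = (v₂^m, θ₂^m) ∘ π` (`FamilyData.us`), pressure `-phiF^m ∘ π`, force
`(wF^m, h^m) ∘ π` with `h^m` the advection–diffusion residual (= periodised `η'θ^m`, (6.7)),
limit force `(wInf, Hinf) ∘ π`; mean energy `≤ B + 1`; mean dissipation
`≥ ν_m ∫_{3/4}^{1} ‖∇θ^m‖² → 1/2` by (6.4), hence `≥ 1/4` from some index on (the sequence is
re-indexed from there); `c = (1/4)/(B+1)^{3/2}` for the Doering–Foias reading. Continuity in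
time of the dissipation functionals is the accepted `IsSmoothSpaceTimeOn.continuousOn_gradNormSq`
(`TorusClassicalLerayHopfProofs`) / `.continuousOn_scalarGradNormSq` (`CheskidovAssemblyTools`).

## References

* A. Cheskidov, arXiv:2311.04182 (2023), Thm. 1.3 (p. 5), §6 (pp. 18–19).
-/

open MeasureTheory Set Filter Topology Function
open Literature.Analysis.FunctionSpaces.Torus (twoHalf planarProj)

noncomputable section

namespace Literature.Analysis.FluidPDE

/-! ## A sign lemma -/

namespace Torus

variable {d : Type*} [Fintype d]

/-- `∇(-φ) = -∇φ` for `C¹` scalars on the torus. [folklore] -/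
theorem gradient_neg {φ : UnitAddTorus d → ℝ} (hφ : FunctionSpaces.Torus.IsContDiff 1 φ) (x : UnitAddTorus d) :
    FunctionSpaces.Torus.gradient (fun y => -φ y) x = -FunctionSpaces.Torus.gradient φ x := by
  rw [show (fun y => -φ y) = fun y => (-1 : ℝ) * φ y from funext fun y => (neg_one_mul _).symm,
    Torus.gradient_const_mul hφ, neg_one_smul]

end Torus

namespace CheskidovPeriodic

/-- The flat three-torus (local notation). [folklore] -/
local notation "𝕋³" => UnitAddTorus (Fin 3)
/-- The flat two-torus (local notation). [folklore] -/
local notation "𝕋²" => UnitAddTorus (Fin 2)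
/-- `ℝ³` (local notation). [folklore] -/
local notation "E³" => EuclideanSpace ℝ (Fin 3)
/-- `ℝ²` (local notation). [folklore] -/
local notation "E²" => EuclideanSpace ℝ (Fin 2)

namespace FamilyData

variable (D : FamilyData) (hH : FunctionSpaces.Torus.smooth_leray_helmholtz (Fin 2))

/-! ## The witnesses -/

/-- The velocity `u^{ν_m} = (v₂^m, θ₂^m) ∘ π` on `ℝ × T³` (Cheskidov 2023, §6, p. 18, with
`a_m = 1`). [cite: Cheskidov2023, §6 p. 18] -/
def us (m : ℕ) (t : ℝ) : 𝕋³ → E³ := twoHalf (D.v2 m t) (D.theta2 m t)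

/-- The pressure `p^{ν_m} = -phiF^m ∘ π` (absorbing the gradient part of the drift force). [folklore] -/
def ps (m : ℕ) (t : ℝ) : 𝕋³ → ℝ := (fun y => -D.phiF hH m t y) ∘ planarProj

/-- The force `f^{ν_m}`: the `2½`-dimensional residual force with planar potential `-phiF^m`, i.e.
`(wF^m, h^m) ∘ π` (`fs_eq`). [cite: Cheskidov2023, §6 p. 18] -/
def fs (m : ℕ) : ℝ → 𝕋³ → E³ :=
  Torus.twoHalfForce univ (D.ν m) (D.v2 m) (D.theta2 m) (fun t y => -D.phiF hH m t y)

/-- The limit force `f = (wInf, Hinf) ∘ π`. [cite: Cheskidov2023, §6 p. 18] -/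
def fLim (t : ℝ) : 𝕋³ → E³ := twoHalf (D.wInf hH t) (D.Hinf t)

/-! ## The Navier–Stokes equations and the structure of the force -/

/-- **`(u^{ν_m}, p^{ν_m})` solves the Navier–Stokes system with force `f^{ν_m}` on `ℝ × T³`.** [cite: Cheskidov2023, §6 p. 18] -/
theorem us_isClassicalNSSolutionOn (m : ℕ) :
    FunctionSpaces.Torus.IsClassicalNSSolutionOn univ (D.ν m) (D.fs hH m) (D.us m) (D.ps hH m) :=
  Torus.isClassicalNSSolutionOn_twoHalf uniqueDiffOn_univ (D.ν m) (D.v2_smooth m) (D.theta2_smooth m)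
    (D.phiF_smooth hH m).neg fun t _ => D.v2_divFree m t

/-- **Structure of the force**: `f^{ν_m}(t) = (wF^m(t), h^m(t)) ∘ π` with `h^m` the
advection–diffusion residual of `(v₂^m, θ₂^m)` (the drift part `∂ₜv₂ + (v₂·∇)v₂ - νΔv₂ - ∇phiF`
is the solenoidal part `wF`). [cite: Cheskidov2023, §6 p. 18] -/
theorem fs_eq (m : ℕ) :
    D.fs hH m = fun t => twoHalf (D.wF hH m t) (Torus.adResidual (D.ν m) (D.v2 m) (D.theta2 m) t) := by
  funext t
  rw [fs, Torus.twoHalfForce]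
  congr 1
  funext y
  have hφ1 : FunctionSpaces.Torus.IsContDiff 1 (D.phiF hH m t) :=
    ((D.phiF_smooth hH m).isSmooth_slice (mem_univ t)).isContDiff (by simp)
  rw [Torus.gradient_neg hφ1, ← Torus.nsBodyForce_apply, D.nsBodyForce_v2_eq hH m t y]
  abel

/-- `f^{ν_m}` is jointly smooth. [folklore] -/
theorem fs_smooth (m : ℕ) : FunctionSpaces.Torus.IsSmoothSpaceTimeOn univ (D.fs hH m) := by
  rw [D.fs_eq hH]
  exact (D.wF_smooth hH m).twoHalf (D.adResidual_v2_theta2_smooth m)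

/-- `f^{ν_m}` is `1`-periodic. [folklore] -/
theorem fs_periodic (m : ℕ) : Periodic (D.fs hH m) 1 := by
  rw [D.fs_eq hH]
  exact Torus.periodic_twoHalf (D.wF_periodic hH m) (D.adResidual_v2_theta2_periodic m)

/-- `f^{ν_m}(t)` is divergence free. [folklore] -/
theorem fs_divFree (m : ℕ) (t : ℝ) : FunctionSpaces.Torus.IsDivFree (D.fs hH m t) := by
  rw [D.fs_eq hH]
  exact (D.wF_divFree hH m t).twoHalf _

/-- `f^{ν_m}(t)` has zero mean. [folklore] -/
theorem fs_zeroMean (m : ℕ) (t : ℝ) : FunctionSpaces.Torus.HasZeroMean (D.fs hH m t) := by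
  rw [D.fs_eq hH]
  exact Torus.hasZeroMean_twoHalf ((D.wF_smooth hH m).isSmooth_slice (mem_univ t)).integrable
    ((D.adResidual_v2_theta2_smooth m).isSmooth_slice (mem_univ t)).integrable (D.wF_zeroMean hH m t)
    (D.adResidual_v2_theta2_zeroMean m t)

/-- The limit force is `1`-periodic. [folklore] -/
theorem fLim_periodic : Periodic (D.fLim hH) 1 :=
  Torus.periodic_twoHalf (D.wInf_periodic hH) D.Hinf_periodic

/-- **The limit force is in `C(ℝ; L²(T³))`.** [cite: Cheskidov2023, Thm. 1.3] -/
theorem fLim_continuousInLpOn : Torus.ContinuousInLpOn univ 2 (D.fLim hH) :=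
  Torus.continuousInLpOn_twoHalf (D.wInf_continuousInLpOn hH) (D.Hinf_smooth.continuousInLpOn 2)

/-- **`f^{ν_m} → f` in `C(ℝ; L²)`**: `sup_t ‖f^{ν_m}(t) - f(t)‖_{L²(T³)} → 0`. [cite: Cheskidov2023, Thm. 1.3] -/
theorem tendsto_fs_sub_fLim :
    Tendsto (fun m => ⨆ t : ℝ, eLpNorm (D.fs hH m t - D.fLim hH t) 2 volume) atTop (𝓝 0) := by
  have h := (D.tendsto_wF_sub_wInf hH).add D.tendsto_adResidual_sub_Hinf
  rw [add_zero] at h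
  refine tendsto_of_tendsto_of_tendsto_of_le_of_le' tendsto_const_nhds h
    (Eventually.of_forall fun _ => zero_le) (Eventually.of_forall fun m => iSup_le fun t => ?_)
  rw [D.fs_eq hH, fLim]
  refine (Torus.eLpNorm_twoHalf_sub_twoHalf_le ?_ ?_ ?_ ?_ one_le_two).trans (add_le_add ?_ ?_)
  · exact ((D.wF_smooth hH m).isSmooth_slice (mem_univ t)).continuous.aestronglyMeasurable
  · exact (D.wInf_spec hH t).1.continuous.aestronglyMeasurable
  · exact ((D.adResidual_v2_theta2_smooth m).isSmooth_slice (mem_univ t)).continuous.aestronglyMeasurable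
  · exact (D.Hinf_smooth.isSmooth_slice (mem_univ t)).continuous.aestronglyMeasurable
  · exact le_iSup (fun t => eLpNorm (D.wF hH m t - D.wInf hH t) 2 volume) t
  · exact le_iSup (fun t => eLpNorm (Torus.adResidual (D.ν m) (D.v2 m) (D.theta2 m) t - D.Hinf t) 2 volume) t

/-! ## The velocity: periodicity, mean, energy, dissipation -/

/-- `u^{ν_m}` is `1`-periodic. [folklore] -/
theorem us_periodic (m : ℕ) : Periodic (D.us m) 1 :=
  Torus.periodic_twoHalf (D.v2_periodic m) (D.theta2_periodic m)

/-- `u^{ν_m}(t)` has zero mean. [folklore] -/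
theorem us_zeroMean (m : ℕ) (t : ℝ) : FunctionSpaces.Torus.HasZeroMean (D.us m t) :=
  Torus.hasZeroMean_twoHalf ((D.v2_smooth m).isSmooth_slice (mem_univ t)).integrable
    ((D.theta2_smooth m).isSmooth_slice (mem_univ t)).integrable (D.v2_zeroMean m t) (D.theta2_zeroMean m t)

/-- Pointwise-in-time energy bound `∫ ‖u^{ν_m}(t)‖² ≤ B + 1`. [cite: Cheskidov2023, §6 (6.5)] -/
theorem integral_norm_sq_us_le (m : ℕ) (t : ℝ) : ∫ x, ‖D.us m t x‖ ^ 2 ≤ D.B + 1 := by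
  rw [us, Torus.integral_norm_sq_twoHalf ((D.v2_smooth m).isSmooth_slice (mem_univ t)).continuous
    ((D.theta2_smooth m).isSmooth_slice (mem_univ t)).continuous]
  exact add_le_add (D.v2_sq_le m t) (D.theta2_sq_le m t)

/-- **Mean energy bound**: `⟨‖u^{ν_m}‖²⟩ ≤ B + 1` (long-time average = period average). [cite: Cheskidov2023, §6 p. 18] -/
theorem meanEnergy_us_le (m : ℕ) : meanEnergy (D.us m) ≤ D.B + 1 := by
  rw [meanEnergy_eq_of_periodic (D.us_periodic m) one_pos, inv_one, one_mul]
  have hB := D.B_nonneg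
  by_cases hi : IntervalIntegrable (fun t => ∫ x, ‖D.us m t x‖ ^ 2) volume 0 1
  · calc ∫ t in (0 : ℝ)..1, ∫ x, ‖D.us m t x‖ ^ 2 ≤ ∫ _ in (0 : ℝ)..1, (D.B + 1) :=
          intervalIntegral.integral_mono_on zero_le_one hi intervalIntegrable_const
            fun t _ => D.integral_norm_sq_us_le m t
      _ = D.B + 1 := by simp
  · rw [intervalIntegral.integral_undef hi]
    linarith

/-- The dissipation integrand of `u^{ν_m}` and its scalar lower bound. [folklore] -/
theorem dissipation_integrand_ge (m : ℕ) (t : ℝ) :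
    D.ν m * Torus.scalarGradNormSq (D.theta2 m t) ≤ D.ν m * (FunctionSpaces.Torus.eGradNormSq (D.us m t)).toReal :=
  mul_le_mul_of_nonneg_left (Torus.scalarGradNormSq_le_toReal_eGradNormSq_twoHalf
    ((D.v2_smooth m).isSmooth_slice (mem_univ t)) ((D.theta2_smooth m).isSmooth_slice (mem_univ t)))
    (D.ν_pos m).le

/-- Continuity of the dissipation integrand of `u^{ν_m}`. [folklore] -/
theorem continuous_dissipation_integrand (m : ℕ) :
    Continuous fun t => D.ν m * (FunctionSpaces.Torus.eGradNormSq (D.us m t)).toReal := by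
  have h : (fun t => D.ν m * (FunctionSpaces.Torus.eGradNormSq (D.us m t)).toReal) = fun t =>
      D.ν m * (FunctionSpaces.Torus.gradNormSq (D.v2 m t) + Torus.scalarGradNormSq (D.theta2 m t)) := by
    funext t
    rw [us, Torus.toReal_eGradNormSq_twoHalf ((D.v2_smooth m).isSmooth_slice (mem_univ t))
      ((D.theta2_smooth m).isSmooth_slice (mem_univ t))]
  rw [h]
  refine continuous_const.mul ?_
  have h1 := (D.v2_smooth m).continuousOn_gradNormSq convex_univ uniqueDiffOn_univ
  have h2 := (D.theta2_smooth m).continuousOn_scalarGradNormSq convex_univ uniqueDiffOn_univ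
  exact (continuousOn_univ.1 h1).add (continuousOn_univ.1 h2)

/-- Continuity of the scalar dissipation integrand of `θ₂^m`. [folklore] -/
theorem continuous_scalar_integrand (m : ℕ) : Continuous fun t => D.ν m * Torus.scalarGradNormSq (D.theta2 m t) :=
  continuous_const.mul (continuousOn_univ.1
    ((D.theta2_smooth m).continuousOn_scalarGradNormSq convex_univ uniqueDiffOn_univ))

/-- On `[3/4, 1]` the periodised cut-off density is the original one: `θ₂^m(t) = θ^m(t)`. [folklore] -/
theorem theta2_eq_θ {m : ℕ} {t : ℝ} (ht : t ∈ Icc (3 / 4 : ℝ) 1) : D.theta2 m t = D.θ m t := by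
  rw [theta2, Literature.Analysis.FunctionSpaces.timePeriodize_eq_self one_pos _ ⟨by linarith [ht.1], by linarith [ht.2]⟩]
  funext x
  rw [theta1, eta_eq_one ⟨ht.1, by linarith [ht.2]⟩, one_smul]

/-- **Mean dissipation lower bound**: `⟨ν_m ‖∇u^{ν_m}‖²⟩ ≥ ν_m ∫_{3/4}^{1} ‖∇θ^m(t)‖² dt`
(period average over the window `[2/5, 7/5]`, drop the drift part and the times outside
`[1 - τ/4, 1]`; Cheskidov 2023, p. 19, first display). [cite: Cheskidov2023, §6 p. 19] -/
theorem meanDissipation_us_ge (m : ℕ) :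
    D.ν m * ∫ t in (3 / 4 : ℝ)..1, Torus.scalarGradNormSq (D.θ m t) ≤ meanDissipation (D.ν m) (D.us m) := by
  have hper : Periodic (fun t => D.ν m * (FunctionSpaces.Torus.eGradNormSq (D.us m t)).toReal) 1 :=
    fun t => by simp only [D.us_periodic m t]
  rw [meanDissipation_eq_of_periodic (D.us_periodic m) one_pos, inv_one, one_mul]
  have e : ∫ t in (0 : ℝ)..1, D.ν m * (FunctionSpaces.Torus.eGradNormSq (D.us m t)).toReal =
      ∫ t in (2 / 5 : ℝ)..2 / 5 + 1, D.ν m * (FunctionSpaces.Torus.eGradNormSq (D.us m t)).toReal := by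
    have := hper.intervalIntegral_add_eq 0 (2 / 5)
    rwa [zero_add] at this
  rw [e]
  have hG := D.continuous_dissipation_integrand m
  have hL := D.continuous_scalar_integrand m
  calc D.ν m * ∫ t in (3 / 4 : ℝ)..1, Torus.scalarGradNormSq (D.θ m t)
      = ∫ t in (3 / 4 : ℝ)..1, D.ν m * Torus.scalarGradNormSq (D.theta2 m t) := by
        rw [← intervalIntegral.integral_const_mul]
        refine intervalIntegral.integral_congr fun t ht => ?_
        rw [uIcc_of_le (by norm_num)] at ht
        simp only [D.theta2_eq_θ ht]
    _ ≤ ∫ t in (2 / 5 : ℝ)..2 / 5 + 1, D.ν m * Torus.scalarGradNormSq (D.theta2 m t) :=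
        intervalIntegral.integral_mono_interval (by norm_num) (by norm_num) (by norm_num)
          (Eventually.of_forall fun t => mul_nonneg (D.ν_pos m).le (Torus.scalarGradNormSq_nonneg _))
          (hL.intervalIntegrable _ _)
    _ ≤ ∫ t in (2 / 5 : ℝ)..2 / 5 + 1, D.ν m * (FunctionSpaces.Torus.eGradNormSq (D.us m t)).toReal :=
        intervalIntegral.integral_mono_on (by norm_num) (hL.intervalIntegrable _ _) (hG.intervalIntegrable _ _)
          fun t _ => D.dissipation_integrand_ge m t

/-- **Eventually the mean dissipation is at least `1/4`** (total dissipation anomaly (6.4) with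
`s = 3/4`: `2ν_m ∫_{3/4}^{1} ‖∇θ^m‖² → 1`). [cite: Cheskidov2023, (6.4) and §6 p. 19] -/
theorem eventually_meanDissipation_ge : ∀ᶠ m in atTop, (4 : ℝ)⁻¹ ≤ meanDissipation (D.ν m) (D.us m) := by
  have h := D.θ_dissipation (3 / 4) ⟨by norm_num, by norm_num⟩
  have h2 : ∀ᶠ m in atTop, (2 : ℝ)⁻¹ < 2 * D.ν m * ∫ t in (3 / 4 : ℝ)..1, Torus.scalarGradNormSq (D.θ m t) :=
    h.eventually (lt_mem_nhds (show (2 : ℝ)⁻¹ < 1 by norm_num))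
  filter_upwards [h2] with m hm
  have h3 := D.meanDissipation_us_ge m
  nlinarith

/-! ## Assembly -/

/-- **Theorem 1.3 of Cheskidov 2023 from the family data and the smooth Leray–Helmholtz
decomposition** (solenoidal normalisation, `ℓ = 1`; the sequence is re-indexed from the index
where the mean dissipation exceeds `1/4`). [cite: Cheskidov2023, Thm. 1.3 and §6] -/
theorem cheskidov_time_periodic_anomaly (D : FamilyData)
    (hH : FunctionSpaces.Torus.smooth_leray_helmholtz (Fin 2)) :
    Literature.Analysis.FluidPDE.cheskidov_time_periodic_anomaly := by
  obtain ⟨m₀, hm₀⟩ := eventually_atTop.1 D.eventually_meanDissipation_ge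
  refine ⟨1, D.fLim hH, fun k => D.ν (m₀ + k), fun k => D.fs hH (m₀ + k), fun k => D.us (m₀ + k),
    fun k => D.ps hH (m₀ + k), one_pos, D.fLim_periodic hH, D.fLim_continuousInLpOn hH,
    fun k => D.ν_pos _, ?_, fun k => ⟨D.fs_smooth hH _, D.fs_periodic hH _, fun t =>
      ⟨D.fs_divFree hH _ t, D.fs_zeroMean hH _ t⟩⟩, ?_,
    fun k => ⟨D.us_isClassicalNSSolutionOn hH _, D.us_periodic _, fun t => D.us_zeroMean _ t⟩,
    ⟨D.B + 1, fun k => D.meanEnergy_us_le _⟩, ⟨4⁻¹, by norm_num, fun k => hm₀ _ (Nat.le_add_right _ _)⟩, ?_⟩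
  · -- `ν_{m₀+k} → 0`
    exact D.ν_tendsto.comp (tendsto_atTop_atTop_of_monotone (fun a b h => Nat.add_le_add_left h _)
      fun n => ⟨n, Nat.le_add_left _ _⟩)
  · -- force convergence along the shifted sequence
    exact (D.tendsto_fs_sub_fLim hH).comp (tendsto_atTop_atTop_of_monotone
      (fun a b h => Nat.add_le_add_left h _) fun n => ⟨n, Nat.le_add_left _ _⟩)
  · -- the Doering–Foias reading: `c U³ ≤ ε` with `c = (1/4) / (B+1)^{3/2}`
    have hE : 0 < D.B + 1 := by linarith [D.B_nonneg]
    refine ⟨4⁻¹ / Real.sqrt (D.B + 1) ^ 3, by positivity, fun k => ?_⟩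
    have hU : rmsVelocity longTimeAvgSup (D.us (m₀ + k)) ≤ Real.sqrt (D.B + 1) := by
      rw [rmsVelocity_eq_sqrt_meanEnergy]
      exact Real.sqrt_le_sqrt (D.meanEnergy_us_le _)
    have hU0 : 0 ≤ rmsVelocity longTimeAvgSup (D.us (m₀ + k)) := by
      rw [rmsVelocity_eq_sqrt_meanEnergy]; exact Real.sqrt_nonneg _
    have hs : 0 < Real.sqrt (D.B + 1) := Real.sqrt_pos.2 hE
    calc 4⁻¹ / Real.sqrt (D.B + 1) ^ 3 * rmsVelocity longTimeAvgSup (D.us (m₀ + k)) ^ 3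
        ≤ 4⁻¹ / Real.sqrt (D.B + 1) ^ 3 * Real.sqrt (D.B + 1) ^ 3 := by
          gcongr
      _ = 4⁻¹ := by field_simp
      _ ≤ meanDissipation (D.ν (m₀ + k)) (D.us (m₀ + k)) := hm₀ _ (Nat.le_add_right _ _)

end FamilyData

end CheskidovPeriodic

/-- **turb.S12 from the mixing core.** Cheskidov's time-periodic dissipation anomaly
(`cheskidov_time_periodic_anomaly`, arXiv:2311.04182 Thm. 1.3, solenoidal normalisation, `ℓ = 1`)
follows from the total-dissipation family of §§3–4 (`cheskidov_total_dissipation_family`, named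
fact) and the smooth Leray–Helmholtz decomposition on `T²` (`Torus.smooth_leray_helmholtz (Fin 2)`,
named fact), by the periodisation argument of §6 carried out in
`CheskidovCutoffs` … `CheskidovHelmholtzForces` and assembled above. [cite: Cheskidov2023, Thm. 1.3 and §6] -/
theorem cheskidov_time_periodic_anomaly_of_family (hF : cheskidov_total_dissipation_family)
    (hH : FunctionSpaces.Torus.smooth_leray_helmholtz (Fin 2)) : cheskidov_time_periodic_anomaly := by
  obtain ⟨D⟩ := CheskidovPeriodic.FamilyData.nonempty hF
  exact D.cheskidov_time_periodic_anomaly hH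

end Literature.Analysis.FluidPDE

end
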